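import Mathlib

/-!
# Route PhotonSphereChannels — the tortoise radius function exists (non-vacuity of the `r`-hypotheses)

The three linear items of route `PhotonSphereChannels` (`UniformPhotonSphereChannels`,
`FixedModeChannels`, `BlindnessInsidePhotonSphere`) quantify over all functions `r : ℝ → ℝ` with
`2M < r`, `r' = 1 - 2M/r` everywhere and `r xc = 3M` — the areal radius as a function of the
Regge–Wheeler tortoise coordinate, pinned so that the photon sphere `r = 3M` sits at `x = xc`.
This file proves that such a function exists for every `M > 0` and every `xc`, so that none of the
three statements is vacuously true in its `r`-quantifier (a prerequisite for any refutation by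
counterexample, and part of a vacuity audit of the route).

Construction: `G u = exp u + 2M·u + C` is a strictly increasing continuous bijection `ℝ → ℝ`;
`r x := 2M + exp (G⁻¹ x)` has `r' = exp (G⁻¹ x) / (exp (G⁻¹ x) + 2M) = 1 - 2M / r x`, and the
constant `C = xc - M - 2M log M` gives `r xc = 3M`. (Equivalently `x = r + 2M log (r - 2M) + const`.)
No new definitions are introduced.
-/

namespace Summit.FinalStateConjecture.FinalStateConjecture.Theorems

open Real Filter Topology

/-- **The tortoise radius function exists.** For every mass `M > 0` and every `xc : ℝ` there is
`r : ℝ → ℝ` with `2M < r x`, `HasDerivAt r (1 - 2M / r x) x` for all `x`, and `r xc = 3M`: the areal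
radius along the Regge–Wheeler tortoise line, normalised so that the photon sphere is at `xc`.
In particular the `r`-hypotheses of `UniformPhotonSphereChannels`, `FixedModeChannels` and
`BlindnessInsidePhotonSphere` (route PhotonSphereChannels) are satisfiable. Proof: invert the
strictly increasing continuous surjection `G u = exp u + 2Mu + C` (`StrictMono.orderIsoOfSurjective`),
put `r = 2M + exp ∘ G⁻¹`, differentiate the inverse (`HasDerivAt.of_local_left_inverse`). -/
theorem tortoise_exists (M : ℝ) (hM : 0 < M) (xc : ℝ) :
    ∃ r : ℝ → ℝ, (∀ x, 2 * M < r x) ∧ (∀ x, HasDerivAt r (1 - 2 * M / r x) x) ∧ r xc = 3 * M := by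
  have h2M : 0 < 2 * M := by positivity
  set C : ℝ := xc - M - 2 * M * Real.log M with hC
  -- the log-radius parametrisation of the tortoise coordinate
  set G : ℝ → ℝ := fun u => Real.exp u + (2 * M * u + C) with hG
  have hG_mono : StrictMono G := by
    intro a b hab
    have h1 : Real.exp a < Real.exp b := Real.exp_lt_exp.mpr hab
    simp only [hG]
    nlinarith
  have hG_cont : Continuous G := by
    simp only [hG]
    fun_prop
  have hG_deriv : ∀ u, HasDerivAt G (Real.exp u + 2 * M) u := by
    intro u
    have h2 : HasDerivAt (fun u : ℝ => 2 * M * u + C) (2 * M) u := by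
      simpa using ((hasDerivAt_id u).const_mul (2 * M)).add_const C
    exact (Real.hasDerivAt_exp u).add h2
  have hG_surj : Function.Surjective G := by
    refine hG_cont.surjective ?_ ?_
    · have hlin : Tendsto (fun u : ℝ => 2 * M * u + C) atTop atTop :=
        tendsto_atTop_add_const_right _ _ (Tendsto.const_mul_atTop h2M tendsto_id)
      exact Real.tendsto_exp_atTop.atTop_add_atTop hlin
    · have hlin : Tendsto (fun u : ℝ => 2 * M * u + C) atBot atBot :=
        tendsto_atBot_add_const_right _ _ (Tendsto.const_mul_atBot h2M tendsto_id)
      exact Real.tendsto_exp_atBot.add_atBot hlin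
  -- invert `G`
  set Φ : ℝ ≃o ℝ := StrictMono.orderIsoOfSurjective G hG_mono hG_surj with hΦ
  have hΦapply : ∀ u, Φ u = G u := fun u => rfl
  set g : ℝ → ℝ := fun x => Φ.symm x with hg
  have hg_cont : Continuous g := Φ.symm.continuous
  have hfg : ∀ y, G (g y) = y := fun y => by
    rw [← hΦapply]; exact Φ.apply_symm_apply y
  have hg_deriv : ∀ x, HasDerivAt g (Real.exp (g x) + 2 * M)⁻¹ x := by
    intro x
    have hne : Real.exp (g x) + 2 * M ≠ 0 := by positivity
    exact HasDerivAt.of_local_left_inverse hg_cont.continuousAt (hG_deriv (g x)) hne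
      (Eventually.of_forall hfg)
  refine ⟨fun x => 2 * M + Real.exp (g x), fun x => ?_, fun x => ?_, ?_⟩
  · have : 0 < Real.exp (g x) := Real.exp_pos _
    linarith
  · have hexp : HasDerivAt (fun x => Real.exp (g x))
        (Real.exp (g x) * (Real.exp (g x) + 2 * M)⁻¹) x := (hg_deriv x).exp
    have hsum : HasDerivAt (fun x => 2 * M + Real.exp (g x))
        (0 + Real.exp (g x) * (Real.exp (g x) + 2 * M)⁻¹) x :=
      (hasDerivAt_const x (2 * M)).add hexp
    have hpos : 0 < Real.exp (g x) + 2 * M := by positivity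
    have heq : 0 + Real.exp (g x) * (Real.exp (g x) + 2 * M)⁻¹ =
        1 - 2 * M / (2 * M + Real.exp (g x)) := by
      field_simp
      ring
    simpa [heq] using hsum
  · -- `g xc = log M` because `G (log M) = xc` by the choice of `C`
    have hval : G (Real.log M) = xc := by
      simp only [hG]
      rw [Real.exp_log hM, hC]
      ring
    have hgxc : g xc = Real.log M := by
      have : Φ.symm (Φ (Real.log M)) = Real.log M := Φ.symm_apply_apply _
      rw [hΦapply, hval] at this
      exact this
    show 2 * M + Real.exp (g xc) = 3 * M
    rw [hgxc, Real.exp_log hM]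
    ring

end Summit.FinalStateConjecture.FinalStateConjecture.Theorems
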